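import Summits.SmoothPoincare4.SmoothPoincare4.Theses.SymplecticOrigami

/-!
# `OrigamiRung` — negative-side support: refutation cost

Crux `SymplecticOrigami.OrigamiRung` (item stmt-SmoothPoincare4-7843), cdisprove seat.

* `not_smoothPoincare4_of_not_origamiRung`: the first disjunct of the rung's conclusion is the
  summit's conclusion for the same `M` (same binders as Mathlib's
  `ContinuousMap.HomotopyEquiv.NonemptyDiffeomorphSphere M 4`), so a refutation of the crux is a
  refutation of the summit: any counterexample is an exotic 4-sphere (carrying fold data whose
  pieces are not both doors).  No finite / degenerate / junk model can kill the crux.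
* `strongestRung_iff_smoothPoincare4`: the variant with EVERY hypothesis on the fold data deleted
  and the door escape deleted is EQUIVALENT to the summit (the data telescope is inhabited by junk:
  `N i = S⁴` with the zero form, `S i = S²`, constant maps).  Every "`OrigamiRung` without
  hypothesis `H`" is sandwiched between the two (`not_strongestRung_of_not_origamiRung`), so the
  hypotheses are load-bearing for the proof method only (b⁺ = 1 Seiberg–Witten, adjunction, the
  collar lemma), never for the truth value modulo the summit.
-/

noncomputable section

-- the prescribed namespace `Summit.<P>.<Sub>.…` duplicates `SmoothPoincare4` (P = Sub)
set_option linter.dupNamespace false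

open scoped Manifold ContDiff Topology ContinuousMap

namespace Summit.SmoothPoincare4.SmoothPoincare4.Theorems.OrigamiRung.Negative

open Summit.SmoothPoincare4.SmoothPoincare4.Theses.SymplecticOrigami

/-- **Refutation cost of the crux.** `¬ OrigamiRung → ¬ SmoothPoincare4`: the rung's first
disjunct `Nonempty (M ≃ₘ S⁴)` is the summit's conclusion for the same `M`, so the summit implies
the rung uniformly in the fold data, and killing the rung kills the summit. [folklore] -/
theorem not_smoothPoincare4_of_not_origamiRung (h : ¬ OrigamiRung) : ¬ _root_.SmoothPoincare4 := by
  intro hs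
  refine h ?_
  intro M _ _ _ _ _ e V N _ _ _ _ _ _ _ s S _ _ _ _ _ b β _ _
  exact Or.inl (hs M inferInstance inferInstance e)

/-- **The strongest variant of the rung is the summit.**  Same binders as `OrigamiRung`, no
hypothesis on the fold data, no door escape (the four reflexive equations only name the otherwise
unused data): this statement is equivalent to `SmoothPoincare4`.  `→`: instantiate the data by
junk (`V i = ⊥`, `N i = S⁴` with the zero 2-form, `S i = S²`, constant maps to a pole);
`←`: immediate. [folklore] -/
theorem strongestRung_iff_smoothPoincare4 :
    (∀ (M : Type) [TopologicalSpace M] [T2Space M] [SecondCountableTopology M]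
      [ChartedSpace (EuclideanSpace ℝ (Fin 4)) M] [IsManifold (𝓡 4) ∞ M],
      M ≃ₕ (Metric.sphere (0 : EuclideanSpace ℝ (Fin 5)) 1) →
      ∀ (V : Fin 2 → TopologicalSpace.Opens M) (N : Fin 2 → Type) [∀ i, TopologicalSpace (N i)]
        [∀ i, T2Space (N i)] [∀ i, SecondCountableTopology (N i)] [∀ i, CompactSpace (N i)]
        [∀ i, ConnectedSpace (N i)] [∀ i, ChartedSpace (EuclideanSpace ℝ (Fin 4)) (N i)]
        [∀ i, IsManifold (𝓡 4) ∞ (N i)]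
        (s : ∀ i, Literature.Geometry.Kaehler.MForm (𝓡 4) (N i) ℝ 2) (S : Fin 2 → Type)
        [∀ i, TopologicalSpace (S i)] [∀ i, CompactSpace (S i)] [∀ i, ConnectedSpace (S i)]
        [∀ i, ChartedSpace (EuclideanSpace ℝ (Fin 2)) (S i)] [∀ i, IsManifold (𝓡 2) ∞ (S i)]
        (b : ∀ i, S i → N i) (β : ∀ i, M → N i),
        V = V → s = s → b = b → β = β → Nonempty (M ≃ₘ⟮𝓡 4, 𝓡 4⟯ (Metric.sphere (0 : EuclideanSpace ℝ (Fin 5)) 1))) ↔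
      _root_.SmoothPoincare4 := by
  unfold _root_.SmoothPoincare4 Literature.SPC4.SmoothPoincareConjectureFour
    ContinuousMap.HomotopyEquiv.NonemptyDiffeomorphSphere
  constructor
  · intro h M _ _ _ _ _ e
    haveI : CompactSpace (Metric.sphere (0 : EuclideanSpace ℝ (Fin 5)) 1) := isCompact_iff_compactSpace.1 (isCompact_sphere _ _)
    haveI : CompactSpace (Metric.sphere (0 : EuclideanSpace ℝ (Fin 3)) 1) := isCompact_iff_compactSpace.1 (isCompact_sphere _ _)
    haveI : ConnectedSpace (Metric.sphere (0 : EuclideanSpace ℝ (Fin 5)) 1) := by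
      refine isConnected_iff_connectedSpace.mp (isConnected_sphere ?_ 0 zero_le_one)
      rw [← Module.finrank_eq_rank, finrank_euclideanSpace_fin]
      norm_num
    haveI : ConnectedSpace (Metric.sphere (0 : EuclideanSpace ℝ (Fin 3)) 1) := by
      refine isConnected_iff_connectedSpace.mp (isConnected_sphere ?_ 0 zero_le_one)
      rw [← Module.finrank_eq_rank, finrank_euclideanSpace_fin]
      norm_num
    let p : (Metric.sphere (0 : EuclideanSpace ℝ (Fin 5)) 1) := ⟨EuclideanSpace.single 0 1, by simp⟩
    exact h M e (fun _ => ⊥) (fun _ => (Metric.sphere (0 : EuclideanSpace ℝ (Fin 5)) 1)) (fun _ => 0) (fun _ => (Metric.sphere (0 : EuclideanSpace ℝ (Fin 3)) 1)) (fun _ _ => p)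
      (fun _ _ => p) rfl rfl rfl rfl
  · intro h M _ _ _ _ _ e V N _ _ _ _ _ _ _ s S _ _ _ _ _ b β _ _ _ _
    exact h M inferInstance inferInstance e

/-- **Sandwich.**  `¬ OrigamiRung` refutes the strongest variant as well (trivially: the strongest
variant implies the rung), so together with `strongestRung_iff_smoothPoincare4` every intermediate
"`OrigamiRung` minus one hypothesis" is refutable only by an exotic 4-sphere. [folklore] -/
theorem not_strongestRung_of_not_origamiRung (h : ¬ OrigamiRung) :
    ¬ (∀ (M : Type) [TopologicalSpace M] [T2Space M] [SecondCountableTopology M]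
      [ChartedSpace (EuclideanSpace ℝ (Fin 4)) M] [IsManifold (𝓡 4) ∞ M],
      M ≃ₕ (Metric.sphere (0 : EuclideanSpace ℝ (Fin 5)) 1) →
      ∀ (V : Fin 2 → TopologicalSpace.Opens M) (N : Fin 2 → Type) [∀ i, TopologicalSpace (N i)]
        [∀ i, T2Space (N i)] [∀ i, SecondCountableTopology (N i)] [∀ i, CompactSpace (N i)]
        [∀ i, ConnectedSpace (N i)] [∀ i, ChartedSpace (EuclideanSpace ℝ (Fin 4)) (N i)]
        [∀ i, IsManifold (𝓡 4) ∞ (N i)]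
        (s : ∀ i, Literature.Geometry.Kaehler.MForm (𝓡 4) (N i) ℝ 2) (S : Fin 2 → Type)
        [∀ i, TopologicalSpace (S i)] [∀ i, CompactSpace (S i)] [∀ i, ConnectedSpace (S i)]
        [∀ i, ChartedSpace (EuclideanSpace ℝ (Fin 2)) (S i)] [∀ i, IsManifold (𝓡 2) ∞ (S i)]
        (b : ∀ i, S i → N i) (β : ∀ i, M → N i),
        V = V → s = s → b = b → β = β → Nonempty (M ≃ₘ⟮𝓡 4, 𝓡 4⟯ (Metric.sphere (0 : EuclideanSpace ℝ (Fin 5)) 1))) := by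
  intro hs
  refine h ?_
  intro M _ _ _ _ _ e V N _ _ _ _ _ _ _ s S _ _ _ _ _ b β _ _
  exact Or.inl (hs M e V N s S b β rfl rfl rfl rfl)

end Summit.SmoothPoincare4.SmoothPoincare4.Theorems.OrigamiRung.Negative

end
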